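import Summits.BirchSwinnertonDyer.BirchSwinnertonDyer.Theorems.PrintX11aUpperNonSurjThreeSharpDescent
import Literature.NumberTheory.EllipticCurves.KatoFineSelmerFiniteProofs
import Literature.NumberTheory.EllipticCurves.FineSelmerTorsionCoefficientsFiniteProofs
import HarnessLib

/-!
# Route `PrintX11a`, child crux U3 = `PrintX11a.UpperNonSurjThree` (item stmt-BirchSwinnertonDyer-20613),
# line «finemu3», stub `FineMu.stub_conjA_three` — the ♯0 certificate «`R♯(E,p) = 0`» UNPACKED to level-0 LOCAL
# conditions: a class `y ∈ H¹(K, E[p])` restricting into `Sel₀(K_∞, E[p^∞])` is UNRAMIFIED outside `S = {bad} ∪ {v ∣ p}`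
# and satisfies, at EVERY finite place `v`, the local condition «`loc_v y ↦ 0` in `H¹(K_{∞,w}, E[p^∞])`»; hence the
# ♯0 door from the finite local certificate `R♭(E,p) := {y ∈ H¹(G_ℚ, E[p]; S) : loc_v y ∈ B_v ∀ v} = 0`
# (cell `bsd-print-x11a`, width seat `bsd-line-x11a-p1-w2`; REF g17 booking note (i) on p608099; `--supports` 20613)

HONEST FRAMING.  BSD is not proved by any of this; nothing is asserted about any curve; the crux and its stub
`stub_conjA_three` stay OPEN.  THEOREMS ONLY (no definition, no named fact, no `sorry`), all PROVED from tree theorems.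

WHAT.  REF g17's booking note (i) on `…SharpDescent` (STATUS 2026-08-28T05:58:04Z): the certificate of the ♯0 theorem,
«every `y ∈ H¹(ℚ, E[p])` whose restriction to `ℚ_∞` lands in `Sel₀(ℚ_∞, E[p^∞])` is `0`», carries an `ℚ_∞`-LEVEL Selmer
membership; a record can discharge it by computation only once that membership is translated into finitely many
LOCAL conditions at level 0.  This file proves the translation in the direction a CERTIFICATE needs (membership ⟹
local conditions; so «no non-zero `y` satisfies the local conditions» ⟹ «`R♯(E,p) = 0`»):

* §1 (any number field `K`, any elliptic `W/K`, any CYCLOTOMIC `ℤ_p`-datum `κ`, any `y ∈ H¹(K, E[p])`): if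
  `ι(res_{K_∞} y) ∈ Sel₀(K_∞, E[p^∞])` then
  (a) `y ∈ H¹(G_K, E[p]; S)` — unramified at EVERY prime `𝔓` of `\bar ℤ_K` above every place `v ∉ S`,
      `S = {bad places} ∪ {v ∣ p}` (`resOfLe_eq_zero`: the fine condition «locally trivial above `v`» is Greenberg's
      `awayKer`; Silverman X.4.4 cocycle argument = tree `AcSelmer.resOfLe_torsion_eq_zero_of_forall_conjH1_mem_awayKer`;
      `I_𝔓 ≤ Gal(K̄/K_∞)` as `K_∞/K` is unramified outside `p`, tree `ZpExtension.IsCyclotomic.inertia_le_kerSubgroup`);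
  (b) for EVERY finite place `v`: `ι_v (res_{Gal(K̄/K_∞) ⊓ D_v} y) = 0` in `H¹(Gal(K̄/K_∞) ⊓ D_v, E[p^∞])` — the restriction
      of `y` to the decomposition group of `K_∞` at the chosen place above `v`, pushed to `E[p^∞]`, vanishes
      («`loc_v y ∈ B_v := ker(H¹(K_v, E[p]) → H¹(K_{∞,w}, E[p^∞]))`»; `mem_fineSelmerInfty_iff_resOfLe` at `σ = 1` +
      the naturalities `resOfLe_torsionToPrimaryH1Sub`, `ZpDescent.resOfLe_resSubgroup`).
  (c) at a GOOD place `v ∤ p` condition (b) says exactly `res_{Gal(K̄/K_∞) ⊓ D_v} y = 0` already with `E[p]`-coefficients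
      (the local `ι` is injective there: tree `eq_zero_of_torsionToPrimaryH1Sub_eq_zero_of_hasGoodReductionAt`).
* §2 (over `ℚ`, `E[p]` irreducible, `ρ̄` not onto): the ♯0 theorem with the LOCAL certificate —
  `conjAAt_of_irr_of_not_surj_of_forall_local`: if for every cyclotomic `κ` the only class `y ∈ H¹(G_ℚ, E[p]; S)` with
  `ι_v(res_{D_v ∩ G_∞} y) = 0` at every finite `v` is `y = 0` («`R♭(E,p) = 0`», `R♭ ⊇ R♯`), then statement (A)
  `Rank1Residual.ConjAAt W p` (and `Sel₀(ℚ_∞, E[p^∞]) = 0`); §3 the door on `ClassX11a W p ∧ ¬ Surj W p`.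

WHAT A KIT ENGINE EVALUATES, and what is NOT claimed.  `R♭(E,p)` is a subgroup of the FINITE group `H¹(G_ℚ, E[p]; S)`
(Silverman X.4.3; `= Hom_G(G_{L,S}^{ab}/p, E[p])` on the tame locus, `L = ℚ(E[p])`), cut out by one local condition
`B_v` per `v ∈ S` (for `v ∉ S` condition (b) follows from unramifiedness and adds nothing an engine must check — it
may simply not use it).  The converse translations («unramified at good `v ∤ p` ⟹ (b) at `v`», and the explicit
Tate-curve / unramified-tower formulae for `B_v` at `v ∈ S`) are NOT proved here: they are needed only to show
`R♭ = R♯`, not to book «`R♭ = 0 ⟹ (A)`», and stay the engine's audited paper steps (REF-AUDIT next item).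

References: [GreenbergLNM1716] §3 Lemmas 3.1–3.3 (local kernels over the cyclotomic tower); [Greenberg1989] §1 p. 98
(«locally trivial», `awayKer`); [SilvermanAEC2009] Lemma X.4.3, Cor. X.4.4; [CoatesSujatha2005] §3 statement (A);
[DeoRaySujatha2023] §3 (c1)–(c3); [Washington1997] §13.1 (`ℚ_∞/ℚ` unramified outside `p`); REF STATUS 05:58:04Z (i).
-/

set_option linter.dupNamespace false
set_option autoImplicit false

noncomputable section

open scoped Classical

open WeierstrassCurve Field NumberField IsDedekindDomain
  Literature.NumberTheory.EllipticCurves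
  Literature.NumberTheory.EllipticCurves.GreenbergSelmer
  Literature.NumberTheory.EllipticCurves.Castella2018
  Literature.NumberTheory.EllipticCurves.Rank1Residual
  Literature.NumberTheory.GaloisRepresentations
  Summit.BirchSwinnertonDyer.Rank1Residual

namespace Summit.BirchSwinnertonDyer.BirchSwinnertonDyer.Theorems.UpperNonSurjThreeSharp

universe u

/-! ### §1 Any number field: fine membership of `ι(res y)` ⟹ `y` unramified outside `S` and locally ♯-trivial -/

section Unpack

variable {K : Type} [Field K] [NumberField K] (W : WeierstrassCurve K) [W.IsElliptic] {p : ℕ} [Fact p.Prime]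
  (κ : ZpExtension K p)

/-- **(a) Unramified outside `S`.**  For a CYCLOTOMIC `ℤ_p`-datum `κ` and `y ∈ H¹(K, E[p])` whose restriction to
`Gal(K̄/K_∞)`, pushed to `E[p^∞]`, lies in `Sel₀(K_∞, E[p^∞])`: `y` restricts to `0` on the inertia group of EVERY
prime `𝔓` of `\bar ℤ_K` above every place `v` of good reduction with `v ∤ p` — i.e. `y ∈ H¹(G_K, E[p]; S)`,
`S = {bad} ∪ {v ∣ p}` (`Literature.…h1Unramified`).  The fine condition at `v ∤ p` is Greenberg's «locally trivial
above `v`» (`awayKer`), Silverman's X.4.4 cocycle argument (tree `AcSelmer.resOfLe_torsion_eq_zero_of_forall_conjH1_mem_awayKer`)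
kills the restriction to `I_𝔓 ≤ Gal(K̄/K_∞)` (`K_∞/K` unramified outside `p`).
[cite: SilvermanAEC2009, Cor. X.4.4 and Lemma X.4.3] [cite: Greenberg1989, §1 p. 98] [cite: Washington1997, §13.1] -/
theorem mem_h1Unramified_of_torsionToPrimaryH1Sub_resSubgroup_mem_fineSelmerInfty (hκ : κ.IsCyclotomic)
    (y : discreteH1 (absoluteGaloisGroup K) (geomTorsion W (p : ℤ)))
    (hy : W.torsionToPrimaryH1Sub p κ.kerSubgroup
      (ResKernel.resSubgroup κ.kerSubgroup (geomTorsion W (p : ℤ)) y) ∈ W.fineSelmerInfty κ) :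
    y ∈ h1Unramified (geomTorsion W (p : ℤ)) (W.badPlaces (𝓞 K) ∪ {v | ((p : ℤ) : 𝓞 K) ∈ v.asIdeal}) := by
  rw [mem_h1Unramified_iff]
  intro v hv 𝔓 h𝔓
  have hv' : v ∉ W.badPlaces (𝓞 K) := fun h ↦ hv (Or.inl h)
  have hpv : (p : 𝓞 K) ∉ v.asIdeal := fun h ↦ hv (Or.inr (by simpa using h))
  have hpv₀ : ((p : ℕ) : 𝓞 K) ∉ v.asIdeal := hpv
  have hle : 𝔓.inertia (absoluteGaloisGroup K) ≤ κ.kerSubgroup :=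
    ZpExtension.IsCyclotomic.inertia_le_kerSubgroup hκ hpv h𝔓
  have hy' := (mem_strictSelmerGroupOver_iff
    (W.torsionToPrimaryH1Sub p κ.kerSubgroup
      (ResKernel.resSubgroup κ.kerSubgroup (geomTorsion W (p : ℤ)) y))).mp hy
  rw [unramifiedKer, ResKernel.mem_subgroupResKer_iff, ← ZpDescent.resOfLe_resSubgroup hle]
  exact AcSelmer.resOfLe_torsion_eq_zero_of_forall_conjH1_mem_awayKer (H := κ.kerSubgroup)
    (fun σ ↦ hy'.1 v hpv₀ σ) hv' hpv h𝔓 hle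

omit [W.IsElliptic] in
/-- **(b) The local ♯-condition at every finite place.**  For ANY `ℤ_p`-datum `κ` and `y ∈ H¹(K, E[p])` with
`ι(res_{K_∞} y) ∈ Sel₀(K_∞, E[p^∞])`: at every finite place `v`, the restriction of `y` to `Gal(K̄/K_∞) ⊓ D_v` (the
decomposition group of `K_∞` at the chosen place above `v`), pushed to `E[p^∞]`-coefficients, vanishes —
«`loc_v y ∈ B_v = ker(H¹(K_v, E[p]) → H¹(K_{∞,w}, E[p^∞]))`».  (`mem_fineSelmerInfty_iff_resOfLe` at `σ = 1`, then the
naturalities `res ∘ ι = ι ∘ res` and `res_{D} ∘ res_{K_∞} = res_{D}`.)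
[cite: GreenbergLNM1716, §3 (local conditions at the places of `F_∞`)] [cite: Greenberg1989, §1 p. 98 (2)–(4)] -/
theorem torsionToPrimaryH1Sub_resSubgroup_inf_decomp_eq_zero_of_mem_fineSelmerInfty
    (y : discreteH1 (absoluteGaloisGroup K) (geomTorsion W (p : ℤ)))
    (hy : W.torsionToPrimaryH1Sub p κ.kerSubgroup
      (ResKernel.resSubgroup κ.kerSubgroup (geomTorsion W (p : ℤ)) y) ∈ W.fineSelmerInfty κ)
    (v : HeightOneSpectrum (𝓞 K)) :
    W.torsionToPrimaryH1Sub p (κ.kerSubgroup ⊓ decomp v)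
      (ResKernel.resSubgroup (κ.kerSubgroup ⊓ decomp v) (geomTorsion W (p : ℤ)) y) = 0 := by
  have h1 := ((FineSelmerCoefficientMap.mem_fineSelmerInfty_iff_resOfLe (M := W.geomPrimaryTorsion p) κ _).mp
    hy).1 v 1
  rw [show conjH1 κ.kerSubgroup (W.geomPrimaryTorsion p) 1 = AddMonoidHom.id _ from
      conjH1_one_holds κ.kerSubgroup (W.geomPrimaryTorsion p), AddMonoidHom.id_apply,
    FineSelmerCoefficientMap.resOfLe_torsionToPrimaryH1Sub, ZpDescent.resOfLe_resSubgroup] at h1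
  exact h1

/-- **(c) At a GOOD place `v ∤ p` (cyclotomic `κ`), condition (b) is the vanishing of `res_{Gal(K̄/K_∞) ⊓ D_v} y` in
`E[p]`-coefficients already** — the local map `H¹(·, E[p]) → H¹(·, E[p^∞])` over `K_{∞,w}` is injective because
`E(K_{∞,w})[p^∞]` is `p`-divisible (tree `eq_zero_of_torsionToPrimaryH1Sub_eq_zero_of_hasGoodReductionAt`).
[cite: GreenbergLNM1716, §3 Lemma 3.3 (proof, p. 87)] -/
theorem resSubgroup_inf_decomp_eq_zero_of_mem_fineSelmerInfty (hκ : κ.IsCyclotomic)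
    (y : discreteH1 (absoluteGaloisGroup K) (geomTorsion W (p : ℤ)))
    (hy : W.torsionToPrimaryH1Sub p κ.kerSubgroup
      (ResKernel.resSubgroup κ.kerSubgroup (geomTorsion W (p : ℤ)) y) ∈ W.fineSelmerInfty κ)
    {v : HeightOneSpectrum (𝓞 K)} (hpv : (p : 𝓞 K) ∉ v.asIdeal) (hv : W.HasGoodReductionAt v) :
    ResKernel.resSubgroup (κ.kerSubgroup ⊓ decomp v) (geomTorsion W (p : ℤ)) y = 0 :=
  FineSelmerCoefficientMap.eq_zero_of_torsionToPrimaryH1Sub_eq_zero_of_hasGoodReductionAt W κ hκ hpv hv _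
    (torsionToPrimaryH1Sub_resSubgroup_inf_decomp_eq_zero_of_mem_fineSelmerInfty W κ y hy v)

end Unpack

/-! ### §2 Over `ℚ`: the ♯0 theorem from the LOCAL level-0 certificate `R♭(E,p) = 0` -/

section OverQ

variable (W : WeierstrassCurve ℚ) [W.IsElliptic] (p : ℕ) [Fact p.Prime]

/-- **The local certificate implies the global one**: if for every cyclotomic `κ` the only class
`y ∈ H¹(G_ℚ, E[p]; S)` (`S = {bad} ∪ {v ∣ p}`) satisfying the local ♯-condition (b) at every finite place is `0`
(«`R♭(E,p) = 0`»), then every `y` restricting into `Sel₀(ℚ_∞, E[p^∞])` is `0` («`R♯(E,p) = 0`», the hypothesis of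
`…SharpDescent`).  PROVED, §1 (a)+(b). [cite: GreenbergLNM1716, §3 Lemmas 3.1–3.3] [cite: SilvermanAEC2009, Lemma X.4.3] -/
theorem sharpResidual_eq_zero_of_forall_local
    (h : ∀ κ : ZpExtension ℚ p, κ.IsCyclotomic →
      ∀ y : discreteH1 (absoluteGaloisGroup ℚ) (geomTorsion W (p : ℤ)),
        y ∈ h1Unramified (geomTorsion W (p : ℤ)) (W.badPlaces (𝓞 ℚ) ∪ {v | ((p : ℤ) : 𝓞 ℚ) ∈ v.asIdeal}) →
        (∀ v : HeightOneSpectrum (𝓞 ℚ),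
          W.torsionToPrimaryH1Sub p (κ.kerSubgroup ⊓ decomp v)
            (ResKernel.resSubgroup (κ.kerSubgroup ⊓ decomp v) (geomTorsion W (p : ℤ)) y) = 0) →
        y = 0) :
    ∀ κ : ZpExtension ℚ p, κ.IsCyclotomic →
      ∀ y : discreteH1 (absoluteGaloisGroup ℚ) (geomTorsion W (p : ℤ)),
        W.torsionToPrimaryH1Sub p κ.kerSubgroup
            (ResKernel.resSubgroup κ.kerSubgroup (geomTorsion W (p : ℤ)) y) ∈ W.fineSelmerInfty κ →
          y = 0 :=
  fun κ hκ y hy ↦ h κ hκ y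
    (mem_h1Unramified_of_torsionToPrimaryH1Sub_resSubgroup_mem_fineSelmerInfty W κ hκ y hy)
    (torsionToPrimaryH1Sub_resSubgroup_inf_decomp_eq_zero_of_mem_fineSelmerInfty W κ y hy)

/-- **THE ♯0 THEOREM WITH THE LOCAL CERTIFICATE — `R♭(E,p) = 0 ⟹ Sel₀(ℚ_∞, E[p^∞]) = 0`**
(`Rank1Residual.FineSelmerTrivialAt W p`) for `E/ℚ` with `E[p]` irreducible and `ρ̄_{E,p}` not surjective.
PROVED, no named fact. [cite: GreenbergLNM1716, §3 Lemmas 3.1–3.3 and §1 p. 60] [cite: CoatesSujatha2005, §3 statement (A)] -/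
theorem fineSelmerTrivialAt_of_irr_of_not_surj_of_forall_local
    (hirr : W.HasIrreducibleModPGaloisRep p) (hns : ¬ W.HasSurjectiveModNGaloisRep p)
    (h : ∀ κ : ZpExtension ℚ p, κ.IsCyclotomic →
      ∀ y : discreteH1 (absoluteGaloisGroup ℚ) (geomTorsion W (p : ℤ)),
        y ∈ h1Unramified (geomTorsion W (p : ℤ)) (W.badPlaces (𝓞 ℚ) ∪ {v | ((p : ℤ) : 𝓞 ℚ) ∈ v.asIdeal}) →
        (∀ v : HeightOneSpectrum (𝓞 ℚ),
          W.torsionToPrimaryH1Sub p (κ.kerSubgroup ⊓ decomp v)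
            (ResKernel.resSubgroup (κ.kerSubgroup ⊓ decomp v) (geomTorsion W (p : ℤ)) y) = 0) →
        y = 0) :
    FineSelmerTrivialAt W p :=
  fineSelmerTrivialAt_of_irr_of_not_surj_of_sharpResidual_eq_zero W p hirr hns
    (sharpResidual_eq_zero_of_forall_local W p h)

/-- **THE ♯0 THEOREM WITH THE LOCAL CERTIFICATE, (A)-form — `R♭(E,p) = 0 ⟹` Coates–Sujatha's statement (A) at the
pair** (`Rank1Residual.ConjAAt W p`, the conclusion of `FineMu.stub_conjA_three` for THIS `W`), for `E/ℚ` with `E[p]`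
irreducible and `ρ̄_{E,p}` not surjective; the certificate quantifies over the FINITE group `H¹(G_ℚ, E[p]; S)` with one
local condition per finite place.  PROVED, no named fact; (A) is asserted for no curve.
[cite: CoatesSujatha2005, §3 statement (A)] [cite: DeoRaySujatha2023, Thm. 3.9 and §3 (c3) (the road replaced on U3)]
[cite: GreenbergLNM1716, §3 Lemmas 3.1–3.3] -/
theorem conjAAt_of_irr_of_not_surj_of_forall_local
    (hirr : W.HasIrreducibleModPGaloisRep p) (hns : ¬ W.HasSurjectiveModNGaloisRep p)
    (h : ∀ κ : ZpExtension ℚ p, κ.IsCyclotomic →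
      ∀ y : discreteH1 (absoluteGaloisGroup ℚ) (geomTorsion W (p : ℤ)),
        y ∈ h1Unramified (geomTorsion W (p : ℤ)) (W.badPlaces (𝓞 ℚ) ∪ {v | ((p : ℤ) : 𝓞 ℚ) ∈ v.asIdeal}) →
        (∀ v : HeightOneSpectrum (𝓞 ℚ),
          W.torsionToPrimaryH1Sub p (κ.kerSubgroup ⊓ decomp v)
            (ResKernel.resSubgroup (κ.kerSubgroup ⊓ decomp v) (geomTorsion W (p : ℤ)) y) = 0) →
        y = 0) :
    ConjAAt W p :=
  (fineSelmerTrivialAt_of_irr_of_not_surj_of_forall_local W p hirr hns h).conjAAt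

end OverQ

/-! ### §3 On the route's domain `ClassX11a W p ∧ ¬ Surj W p` -/

/-- **♯0 door with the LOCAL certificate on the finemu3/finemu5 domain**: at a non-surjective X11a pair, «`R♭(E,p) = 0`»
(no non-zero class of `H¹(G_ℚ, E[p]; S)` is locally ♯-trivial at every finite place) gives statement (A) at the pair.
PROVED, no named fact; nothing asserted about any curve. [cite: CoatesSujatha2005, §3 statement (A)]
[cite: GreenbergLNM1716, §3 Lemmas 3.1–3.3] -/
theorem _root_.Summit.BirchSwinnertonDyer.Rank1Residual.ClassX11a.conjAAt_of_not_surj_of_forall_local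
    (W : WeierstrassCurve ℚ) [W.IsElliptic] [W.IsGloballyMinimal] (p : ℕ) [Fact p.Prime]
    (hX : ClassX11a W p) (hns : ¬ Surj W p)
    (h : ∀ κ : ZpExtension ℚ p, κ.IsCyclotomic →
      ∀ y : discreteH1 (absoluteGaloisGroup ℚ) (geomTorsion W (p : ℤ)),
        y ∈ h1Unramified (geomTorsion W (p : ℤ)) (W.badPlaces (𝓞 ℚ) ∪ {v | ((p : ℤ) : 𝓞 ℚ) ∈ v.asIdeal}) →
        (∀ v : HeightOneSpectrum (𝓞 ℚ),
          W.torsionToPrimaryH1Sub p (κ.kerSubgroup ⊓ decomp v)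
            (ResKernel.resSubgroup (κ.kerSubgroup ⊓ decomp v) (geomTorsion W (p : ℤ)) y) = 0) →
        y = 0) :
    ConjAAt W p :=
  conjAAt_of_irr_of_not_surj_of_forall_local W p hX.irr hns h

end Summit.BirchSwinnertonDyer.BirchSwinnertonDyer.Theorems.UpperNonSurjThreeSharp

end
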